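import Summits.HubbardSuperconductivity.HubbardSuperconductivity.Theses.InfiniteVolumeFirst
import Summits.HubbardSuperconductivity.HubbardSuperconductivity.Theorems.WeakCouplingBCSWcbcsSsbToTorusLROFejerClosure
import Literature.MathematicalPhysics.QuantumLattice.PairFieldEvenSideLRO

/-!
# Route `InfiniteVolumeFirst` — support item `TightnessExchange` (stmt-18535)

The Fejér / compactness exchange lemma: for ANY family `ψ_L` of torus Fock vectors normalised at
even sides, if the small-momentum window tails of the `d`-wave pair structure factor are tight
(`Σ_{m ≠ 0, |q_m| ≤ ε} S_L(m) ≤ η L²` eventually; for every `η` some `ε`) and every pointwise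
subsequential limit `C` (along even sides) of the translation-averaged pair correlations
`C_L(x) = L⁻² Σ_y G_L(x + y, y)` has a positive atom `liminf_R R⁻⁴ Σ_{x,y ∈ [0,R)²} C(x - y) > 0`,
then the pair field has long-range order along the even sides in the summit's format.

Proof (finite-dimensional harmonic analysis + a diagonal argument, no Hamiltonian):
`tightnessExchange_boxSum_eq` — `Σ_{x,y ∈ [0,R)²} C_L(x - y) = L⁻² Σ_a ‖B_a ψ_L‖²` with the block
pair operators `B_a = Σ_{u ∈ [0,R)²} P_{a+u}`; `tightnessExchange_fejer_bound` — by the tree's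
Fejér closure inequality `WcbcsSsbToTorusLRO.stub_fejerClosure` (block Plancherel, box-kernel
bounds, pair sum rule), `R⁻⁴ Σ_{x,y ∈ [0,R)²} C_L(x - y) ≤ LRO_L + L⁻² Σ_{window} S_L + 2π²C_d²/(R²ε²)`;
main theorem — if `liminf_k LRO_{2k} = 0`, extract `LRO_{2k_j} → 0`
(`Filter.extraction_forall_of_frequently`) and a pointwise convergent further subsequence
`C_{L_j} → C` (`|C_L| ≤ C_d²`, `IsCompact.tendsto_subseq` in `[-C_d², C_d²]^{ℤ²}`); the Fejér bound
passes to the limit, `R⁻⁴ Σ_{x,y} C(x - y) ≤ η + 2π²C_d²/(R²ε²)`, so `liminf_R ≤ 2η` for all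
`η > 0`, contradicting the atom.

Sources: Kennedy–Lieb–Shastry, PRL **61** (1988) 2582 (Fourier modes of an order operator, sum
rule); Fröhlich–Simon–Spencer, CMP **50** (1976) 79, §3 and Dyson–Lieb–Simon, JSP **18** (1978)
335 (long-range order from momentum-space bounds); Friedli–Velenik (2017), §3.7.2 and §10.4.
No definition and no named fact is introduced.
-/

noncomputable section

-- the mandated namespace `Summit.<Summit>.<Problem>.Theorems` repeats `HubbardSuperconductivity`
-- (single-problem summit, D-0017), which the `dupNamespace` linter flags on every declaration
set_option linter.dupNamespace false

namespace Summit.HubbardSuperconductivity.HubbardSuperconductivity.Theorems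

open Literature.MathematicalPhysics.QuantumLattice Literature.Probability.LatticeModels Matrix Finset
  Filter
open scoped ComplexConjugate ComplexOrder Topology

/-! ### Reindexing the box `[0,R)²` -/

/-- A sum over the box `halfOpenBox 2 R ⊆ ℤ²` of a function of the projection to the torus is the
sum over the offsets `u : Fin 2 → Fin R` written as `i ↦ ((u i : ℕ) : ZMod L)` (the format of the
tree's block pair operators). Friedli–Velenik (2017) §3.1. [folklore] -/
theorem tightnessExchange_sum_halfOpenBox_eq_sum_fin {M : Type*} [AddCommMonoid M] (L R : ℕ)
    (F : TorusSite 2 L → M) :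
    ∑ x ∈ halfOpenBox 2 R, F (Torus.proj L x) =
      ∑ u : Fin 2 → Fin R, F (fun i => ((u i : ℕ) : ZMod L)) := by
  symm
  refine Finset.sum_nbij (fun u : Fin 2 → Fin R => fun i => ((u i : ℕ) : ℤ)) ?_ ?_ ?_ ?_
  · exact fun u _ => mem_halfOpenBox.2 fun i => ⟨Int.natCast_nonneg _, by exact_mod_cast (u i).2⟩
  · intro u _ u' _ h
    funext i
    have hi : ((u i : ℕ) : ℤ) = ((u' i : ℕ) : ℤ) := congrFun h i
    exact Fin.ext (by exact_mod_cast hi)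
  · intro x hx
    rw [Finset.mem_coe, mem_halfOpenBox] at hx
    refine ⟨fun i => ⟨(x i).toNat, by have h := hx i; omega⟩, by simp, ?_⟩
    funext i
    have h := hx i
    simp only
    omega
  · intro u _
    congr 1
    funext i
    simp [Torus.proj_apply]

/-! ### A priori bounds -/

/-- The translation-averaged pair correlation `C_L(x) = L⁻² Σ_{y ∈ [0,L)²} G_L(x + y, y)` of a
normalised state is bounded by `C_d² = (Σ_{e ∈ {0} ∪ unitSteps} 2|g_d(e)|/√2)²` (Cauchy–Schwarz,
`abs_re_expect_localPair_le`; the value at `L = 0` is the junk value `0`).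
Scalapino, Phys. Rep. 250 (1995) 329, §2. [folklore] -/
theorem tightnessExchange_abs_corrAvg_le (ψ : ∀ L, Fock (Orb (FermionTorus 2 L))) (L : ℕ)
    (hψ : star (ψ L) ⬝ᵥ ψ L = 1) (x : Site 2) :
    |(∑ y ∈ halfOpenBox 2 L, torusPullback (pairFieldCorr dWaveFormFactor ψ) L (x + y) y) /
        ((L : ℕ) : ℝ) ^ 2| ≤
      (∑ e ∈ insert (0 : Site 2) unitSteps,
        ‖((dWaveFormFactor e / Real.sqrt 2 : ℝ) : ℂ)‖ * 2) ^ 2 := by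
  cases L with
  | zero =>
    simp only [Nat.cast_zero, ne_eq, OfNat.ofNat_ne_zero, not_false_eq_true, zero_pow, div_zero,
      abs_zero]
    positivity
  | succ n =>
    rw [abs_div, abs_of_nonneg (by positivity : (0 : ℝ) ≤ ((n + 1 : ℕ) : ℝ) ^ 2),
      div_le_iff₀ (by positivity)]
    calc |∑ y ∈ halfOpenBox 2 (n + 1),
            torusPullback (pairFieldCorr dWaveFormFactor ψ) (n + 1) (x + y) y|
        ≤ ∑ y ∈ halfOpenBox 2 (n + 1),
            |torusPullback (pairFieldCorr dWaveFormFactor ψ) (n + 1) (x + y) y| :=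
          Finset.abs_sum_le_sum_abs _ _
      _ ≤ ∑ y ∈ halfOpenBox 2 (n + 1), (∑ e ∈ insert (0 : Site 2) unitSteps,
            ‖((dWaveFormFactor e / Real.sqrt 2 : ℝ) : ℂ)‖ * 2) ^ 2 :=
          Finset.sum_le_sum fun y _ => by
            rw [torusPullback_apply, pairFieldCorr_succ]
            exact abs_re_expect_localPair_le (ψ (n + 1)) hψ _ _
      _ = (∑ e ∈ insert (0 : Site 2) unitSteps,
            ‖((dWaveFormFactor e / Real.sqrt 2 : ℝ) : ℂ)‖ * 2) ^ 2 * ((n + 1 : ℕ) : ℝ) ^ 2 := by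
          rw [Finset.sum_const, card_halfOpenBox, nsmul_eq_mul]
          push_cast
          ring

/-- The long-range-order sequence `|Λ_L|⁻² Σ_{x,y ∈ Λ_L} G_L(x,y)` of the pair field is
nonnegative (it is `L⁻⁴ ‖Δ_d ψ_L‖²`; junk value `0` at `L = 0`).
Scalapino, Phys. Rep. 250 (1995) 329, §2, eq. (2.4). [folklore] -/
theorem tightnessExchange_lroSeq_nonneg (ψ : ∀ L, Fock (Orb (FermionTorus 2 L))) (L : ℕ) :
    0 ≤ (∑ x ∈ halfOpenBox 2 L, ∑ y ∈ halfOpenBox 2 L,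
        torusPullback (pairFieldCorr dWaveFormFactor ψ) L x y) / ((halfOpenBox 2 L).card : ℝ) ^ 2 := by
  cases L with
  | zero => simp [card_halfOpenBox]
  | succ n =>
    rw [torusLROSeq_pairFieldCorr_succ]
    refine div_nonneg ?_ (by positivity)
    rw [PosSemidefTrace.expect_conjTranspose_mul]
    exact (Complex.nonneg_iff.1 (dotProduct_star_self_nonneg _)).1

/-- The long-range-order sequence of the pair field of a normalised state is at most `C_d²`
(`pairFieldCorr_succ_le`; junk value `0` at `L = 0`).
Scalapino, Phys. Rep. 250 (1995) 329, §2. [folklore] -/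
theorem tightnessExchange_lroSeq_le (ψ : ∀ L, Fock (Orb (FermionTorus 2 L))) (L : ℕ)
    (hψ : star (ψ L) ⬝ᵥ ψ L = 1) :
    (∑ x ∈ halfOpenBox 2 L, ∑ y ∈ halfOpenBox 2 L,
        torusPullback (pairFieldCorr dWaveFormFactor ψ) L x y) / ((halfOpenBox 2 L).card : ℝ) ^ 2 ≤
      (∑ e ∈ insert (0 : Site 2) unitSteps,
        ‖((dWaveFormFactor e / Real.sqrt 2 : ℝ) : ℂ)‖ * 2) ^ 2 := by
  cases L with
  | zero =>
    simp only [card_halfOpenBox, ne_eq, OfNat.ofNat_ne_zero, not_false_eq_true, zero_pow,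
      Nat.cast_zero, div_zero]
    positivity
  | succ n =>
    rw [sum_torusPullback_succ, div_le_iff₀ (by positivity)]
    calc ∑ x : TorusSite 2 (n + 1), ∑ y, pairFieldCorr dWaveFormFactor ψ (n + 1) x y
        ≤ ∑ x : TorusSite 2 (n + 1), ∑ y : TorusSite 2 (n + 1),
            (∑ e ∈ insert (0 : Site 2) unitSteps,
              ‖((dWaveFormFactor e / Real.sqrt 2 : ℝ) : ℂ)‖ * 2) ^ 2 :=
          Finset.sum_le_sum fun x _ => Finset.sum_le_sum fun y _ =>
            pairFieldCorr_succ_le dWaveFormFactor ψ n hψ x y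
      _ = (∑ e ∈ insert (0 : Site 2) unitSteps,
            ‖((dWaveFormFactor e / Real.sqrt 2 : ℝ) : ℂ)‖ * 2) ^ 2 * ((n + 1 : ℕ) : ℝ) ^ (2 * 2) := by
          simp only [Finset.sum_const, Finset.card_univ, Fintype.card_pi, ZMod.card,
            Finset.prod_const, Fintype.card_fin]
          push_cast
          ring

/-! ### The box double sum of `C_L` is block pair coherence -/

/-- **Box sums of the translation-averaged pair correlation are block pair coherence.** For the
side `L = n + 1`, any `R` and any family `ψ`:
`Σ_{x,y ∈ [0,R)²} C_L(x - y) = L⁻² Σ_a Re ⟨B_a ψ_L, B_a ψ_L⟩` with the (wrapping) block pair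
operators `B_a = Σ_{u ∈ [0,R)²} P_{a+u}`: reindex the fundamental domain by the torus, translate
the averaging variable, and use bilinearity. Kennedy–Lieb–Shastry, PRL 61 (1988) 2582. [folklore] -/
theorem tightnessExchange_boxSum_eq (ψ : ∀ L, Fock (Orb (FermionTorus 2 L))) (n R : ℕ) :
    ∑ x ∈ halfOpenBox 2 R, ∑ y ∈ halfOpenBox 2 R,
        (∑ w ∈ halfOpenBox 2 (n + 1),
          torusPullback (pairFieldCorr dWaveFormFactor ψ) (n + 1) (x - y + w) w) /
            ((n + 1 : ℕ) : ℝ) ^ 2 =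
      (∑ a : TorusSite 2 (n + 1),
          star ((∑ u : Fin 2 → Fin R,
              localPair dWaveFormFactor (n + 1) (a + fun i => ((u i : ℕ) : ZMod (n + 1)))) *ᵥ
                ψ (n + 1)) ⬝ᵥ
            ((∑ u : Fin 2 → Fin R,
              localPair dWaveFormFactor (n + 1) (a + fun i => ((u i : ℕ) : ZMod (n + 1)))) *ᵥ
                ψ (n + 1))).re / ((n + 1 : ℕ) : ℝ) ^ 2 := by
  simp only [← Finset.sum_div]
  congr 1
  rw [Complex.re_sum]
  simp only [torusPullback_apply, pairFieldCorr_succ]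
  have hproj : ∀ x y w : Site 2, Torus.proj (n + 1) (x - y + w) =
      Torus.proj (n + 1) x - Torus.proj (n + 1) y + Torus.proj (n + 1) w := fun x y w => by
    funext i
    simp only [Torus.proj_apply, Pi.add_apply, Pi.sub_apply, Int.cast_add, Int.cast_sub]
  simp_rw [hproj]
  have hw : ∀ x y : Site 2,
      ∑ w ∈ halfOpenBox 2 (n + 1), (expect ((localPair dWaveFormFactor (n + 1)
          (Torus.proj (n + 1) x - Torus.proj (n + 1) y + Torus.proj (n + 1) w))ᴴ *
          localPair dWaveFormFactor (n + 1) (Torus.proj (n + 1) w)) (ψ (n + 1))).re =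
        ∑ a : TorusSite 2 (n + 1), (expect ((localPair dWaveFormFactor (n + 1)
          (a + Torus.proj (n + 1) x))ᴴ *
          localPair dWaveFormFactor (n + 1) (a + Torus.proj (n + 1) y)) (ψ (n + 1))).re := by
    intro x y
    rw [sum_halfOpenBox_torusProj (n + 1) (fun t => (expect ((localPair dWaveFormFactor (n + 1)
          (Torus.proj (n + 1) x - Torus.proj (n + 1) y + t))ᴴ *
          localPair dWaveFormFactor (n + 1) t) (ψ (n + 1))).re)]
    refine Fintype.sum_equiv (Equiv.subRight (Torus.proj (n + 1) y)) _ _ fun t => ?_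
    rw [Equiv.subRight_apply, sub_add_cancel,
      show t - Torus.proj (n + 1) y + Torus.proj (n + 1) x =
        Torus.proj (n + 1) x - Torus.proj (n + 1) y + t by abel]
  simp_rw [hw]
  simp_rw [Finset.sum_comm (s := halfOpenBox 2 R) (t := (Finset.univ : Finset (TorusSite 2 (n + 1))))]
  refine Finset.sum_congr rfl fun a _ => ?_
  rw [← tightnessExchange_sum_halfOpenBox_eq_sum_fin (n + 1) R
    (fun t => localPair dWaveFormFactor (n + 1) (a + t))]
  simp only [Matrix.sum_mulVec, star_sum, sum_dotProduct, dotProduct_sum, Complex.re_sum,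
    PosSemidefTrace.expect_conjTranspose_mul]
  exact Finset.sum_comm

/-! ### The Fejér bound at a fixed even side -/

/-- **Fejér bound.** For a normalised state at side `L = n + 1`, any block scale `R > 0` and any
window `ε > 0`:
`R⁻⁴ Σ_{x,y ∈ [0,R)²} C_L(x - y) ≤ LRO_L + L⁻² Σ_{m ≠ 0, |q_m|² ≤ ε²} S_L(m) + 2π² C_d² / (R² ε²)`,
where `LRO_L = |Λ_L|⁻² Σ_{x,y ∈ Λ_L} G_L(x,y) = L⁻⁴ ‖Δ_d ψ_L‖²` and `S_L = pairStructureFactor`.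
This is the tree's Fejér closure inequality `WcbcsSsbToTorusLRO.stub_fejerClosure` (block
Plancherel `Σ_a ‖B_a ψ‖² = Σ_m |F_R(m)|² S_L(m)`, kernel bounds `F_R(0) = R²`, `|F_R| ≤ R²`,
`|F_R(m)|² |q_m|² ≤ 2π² R²`, sum rule `Σ_m S_L(m) ≤ C_d² L²`) rewritten through
`tightnessExchange_boxSum_eq`; the strict window `|q_m|² < ε²` of the stub is enlarged to `≤ ε²`
(nonnegative terms). Kennedy–Lieb–Shastry, PRL 61 (1988) 2582; Friedli–Velenik (2017) §10.4.
[folklore] -/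
theorem tightnessExchange_fejer_bound (ψ : ∀ L, Fock (Orb (FermionTorus 2 L))) (n : ℕ)
    (hψ : star (ψ (n + 1)) ⬝ᵥ ψ (n + 1) = 1) (R : ℕ) (hR : 0 < R) (ε : ℝ) (hε : 0 < ε) :
    (∑ x ∈ halfOpenBox 2 R, ∑ y ∈ halfOpenBox 2 R,
        (∑ w ∈ halfOpenBox 2 (n + 1),
          torusPullback (pairFieldCorr dWaveFormFactor ψ) (n + 1) (x - y + w) w) /
            ((n + 1 : ℕ) : ℝ) ^ 2) / (R : ℝ) ^ 4 ≤
      (∑ x ∈ halfOpenBox 2 (n + 1), ∑ y ∈ halfOpenBox 2 (n + 1),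
          torusPullback (pairFieldCorr dWaveFormFactor ψ) (n + 1) x y) /
            ((halfOpenBox 2 (n + 1)).card : ℝ) ^ 2 +
        (∑ m : TorusSite 2 (n + 1), if m ≠ 0 ∧ momentumNormSq (n + 1) m ≤ ε ^ 2 then
            pairStructureFactor dWaveFormFactor (n + 1) (ψ (n + 1)) m else 0) /
          ((n + 1 : ℕ) : ℝ) ^ 2 +
        2 * Real.pi ^ 2 * (∑ e ∈ insert (0 : Site 2) unitSteps,
          ‖((dWaveFormFactor e / Real.sqrt 2 : ℝ) : ℂ)‖ * 2) ^ 2 / ((R : ℝ) ^ 2 * ε ^ 2) := by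
  classical
  rw [tightnessExchange_boxSum_eq, torusLROSeq_pairFieldCorr_succ]
  have h := WcbcsSsbToTorusLRO.stub_fejerClosure dWaveFormFactor (n + 1) R hR ε hε (ψ (n + 1)) hψ
  have hwin : (∑ m ∈ (Finset.univ.filter fun m : TorusSite 2 (n + 1) =>
        m ≠ 0 ∧ momentumNormSq (n + 1) m < ε ^ 2),
        pairStructureFactor dWaveFormFactor (n + 1) (ψ (n + 1)) m) ≤
      ∑ m : TorusSite 2 (n + 1), if m ≠ 0 ∧ momentumNormSq (n + 1) m ≤ ε ^ 2 then
        pairStructureFactor dWaveFormFactor (n + 1) (ψ (n + 1)) m else 0 := by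
    rw [← Finset.sum_filter]
    refine Finset.sum_le_sum_of_subset_of_nonneg (fun m hm => ?_)
      (fun m _ _ => pairStructureFactor_nonneg _ _ _ _)
    simp only [Finset.mem_filter, Finset.mem_univ, true_and] at hm ⊢
    exact ⟨hm.1, hm.2.le⟩
  have hwin' := div_le_div_of_nonneg_right hwin (sq_nonneg (((n + 1 : ℕ) : ℝ)))
  rw [div_div, mul_comm (((n + 1 : ℕ) : ℝ) ^ 2) ((R : ℝ) ^ 4)]
  linarith

/-! ### The exchange lemma -/

/-- **The Fejér / compactness exchange lemma** (route `InfiniteVolumeFirst`, support item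
`TightnessExchange`, stmt-HubbardSuperconductivity-18535). For any family `ψ` of torus vectors
normalised at even sides: tight small-momentum window tails of the `d`-wave pair structure factor
and a positive condensate atom of every pointwise subsequential limit (along even sides) of the
translation-averaged pair correlations imply `d`-wave pair-field long-range order along the even
sides in the summit's format. Proof: if `liminf_k LRO_{2k} = 0`, pass to `LRO_{2k_j} → 0` and, by a
diagonal (compactness) argument, to pointwise convergence `C_{L_j} → C`; the Fejér bound
`R⁻⁴ Σ_{x,y ∈ [0,R)²} C_{L}(x - y) ≤ LRO_L + η + 2π²C_d²/(R²ε²)` (large even `L`) passes to the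
limit and forces `liminf_R R⁻⁴ Σ_{x,y} C(x - y) ≤ 2η` for every `η > 0`, contradicting the atom.
Kennedy–Lieb–Shastry, PRL 61 (1988) 2582; Fröhlich–Simon–Spencer (1976) §3; Friedli–Velenik (2017)
§3.7.2, §10.4. [folklore] -/
theorem infiniteVolumeFirst_tightnessExchange_proof :
    Summit.HubbardSuperconductivity.HubbardSuperconductivity.Theses.InfiniteVolumeFirst.TightnessExchange := by
  intro ψ hnorm htight hatom
  -- the constant `C_d²`
  obtain ⟨B, hB⟩ : ∃ B : ℝ, B = (∑ e ∈ insert (0 : Site 2) unitSteps,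
      ‖((dWaveFormFactor e / Real.sqrt 2 : ℝ) : ℂ)‖ * 2) ^ 2 := ⟨_, rfl⟩
  have hB0 : 0 ≤ B := by rw [hB]; positivity
  -- the long-range-order sequence
  obtain ⟨u, hu⟩ : ∃ u : ℕ → ℝ, ∀ L, u L = (∑ x ∈ halfOpenBox 2 L, ∑ y ∈ halfOpenBox 2 L,
      torusPullback (pairFieldCorr dWaveFormFactor ψ) L x y) / ((halfOpenBox 2 L).card : ℝ) ^ 2 :=
    ⟨_, fun _ => rfl⟩
  -- the translation-averaged pair correlations
  obtain ⟨Cavg, hCavg⟩ : ∃ Cavg : ℕ → Site 2 → ℝ, ∀ L x, Cavg L x =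
      (∑ y ∈ halfOpenBox 2 L, torusPullback (pairFieldCorr dWaveFormFactor ψ) L (x + y) y) /
        ((L : ℕ) : ℝ) ^ 2 := ⟨_, fun _ _ => rfl⟩
  have hgoal : HasLongRangeOrder (fun k => halfOpenBox 2 (2 * k))
      (fun k => torusPullback (pairFieldCorr dWaveFormFactor ψ) (2 * k)) ↔
      0 < liminf (fun k => u (2 * k)) atTop := by
    simp only [HasLongRangeOrder, hu]
  rw [hgoal]
  by_contra hneg
  have hlim0 : liminf (fun k => u (2 * k)) atTop ≤ 0 := not_lt.1 hneg
  -- a priori bounds at the even sides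
  have hu0 : ∀ k, 0 ≤ u (2 * k) := fun k => by
    rw [hu]; exact tightnessExchange_lroSeq_nonneg ψ _
  have huB : ∀ k, u (2 * k) ≤ B := fun k => by
    rw [hu, hB]; exact tightnessExchange_lroSeq_le ψ _ (hnorm _ (even_two_mul k))
  have hCB : ∀ k x, |Cavg (2 * k) x| ≤ B := fun k x => by
    rw [hCavg, hB]; exact tightnessExchange_abs_corrAvg_le ψ _ (hnorm _ (even_two_mul k)) x
  -- Step 1: a subsequence of even sides along which the LRO sequence tends to `0`
  have hfreq : ∀ N : ℕ, ∃ᶠ k in atTop, u (2 * k) < 1 / ((N : ℝ) + 1) := fun N =>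
    frequently_lt_of_liminf_lt (isCoboundedUnder_ge_of_le atTop huB)
      (hlim0.trans_lt (by positivity))
  obtain ⟨φ₁, hφ₁, hφ₁u⟩ := extraction_forall_of_frequently hfreq
  have hu_tend : Tendsto (fun j => u (2 * φ₁ j)) atTop (𝓝 0) :=
    tendsto_of_tendsto_of_tendsto_of_le_of_le tendsto_const_nhds
      tendsto_one_div_add_atTop_nhds_zero_nat (fun j => hu0 _) (fun j => (hφ₁u j).le)
  -- Step 2: a further subsequence along which `C_L` converges pointwise (diagonal argument)
  obtain ⟨K, hK⟩ : ∃ K : Set (Site 2 → ℝ), K = Set.pi Set.univ fun _ => Set.Icc (-B) B :=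
    ⟨_, rfl⟩
  have hKc : IsCompact K := hK ▸ isCompact_univ_pi fun _ => isCompact_Icc
  have hmem : ∀ j, (fun x => Cavg (2 * φ₁ j) x) ∈ K := fun j =>
    hK ▸ Set.mem_univ_pi.2 fun x => abs_le.1 (hCB _ x)
  obtain ⟨C, hCK, φ₂, hφ₂, hconv⟩ := hKc.tendsto_subseq hmem
  rw [hK] at hCK
  have hCbd : ∀ x, |C x| ≤ B := fun x => abs_le.2 (Set.mem_univ_pi.1 hCK x)
  -- the subsequence of sides
  obtain ⟨Ls, hLs⟩ : ∃ Ls : ℕ → ℕ, ∀ j, Ls j = 2 * φ₁ (φ₂ j) := ⟨_, fun _ => rfl⟩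
  have hLs_mono : StrictMono Ls := fun a b hab => by
    have h := hφ₁ (hφ₂ hab)
    rw [hLs, hLs]
    omega
  have hLs_even : ∀ j, Even (Ls j) := fun j => hLs j ▸ even_two_mul _
  have hLs_conv : ∀ x : Site 2, Tendsto (fun j => Cavg (Ls j) x) atTop (𝓝 (C x)) := fun x =>
    (tendsto_pi_nhds.1 hconv x).congr fun j => by simp only [Function.comp_apply, hLs]
  have hu_tend' : Tendsto (fun j => u (Ls j)) atTop (𝓝 0) :=
    (hu_tend.comp hφ₂.tendsto_atTop).congr fun j => by simp only [Function.comp_apply, hLs]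
  -- Step 3: the atom of the limit
  obtain ⟨b, hb⟩ : ∃ b : ℕ → ℝ, ∀ R, b R = (∑ x ∈ halfOpenBox 2 R, ∑ y ∈ halfOpenBox 2 R,
      C (x - y)) / ((R : ℕ) : ℝ) ^ 4 := ⟨_, fun _ => rfl⟩
  have hatomC : 0 < liminf b atTop := by
    have h := hatom Ls C hLs_mono hLs_even (fun x => by simpa only [hCavg] using hLs_conv x)
    have hfun : (fun R : ℕ => (∑ x ∈ halfOpenBox 2 R, ∑ y ∈ halfOpenBox 2 R, C (x - y)) /
        ((R : ℕ) : ℝ) ^ 4) = b := funext fun R => (hb R).symm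
    rwa [hfun] at h
  have hb_low : ∀ R, -B ≤ b R := by
    intro R
    have habs : |b R| ≤ B := by
      rw [hb, abs_div, abs_of_nonneg (by positivity : (0 : ℝ) ≤ ((R : ℕ) : ℝ) ^ 4)]
      rcases Nat.eq_zero_or_pos R with rfl | hRpos
      · simpa using hB0
      · rw [div_le_iff₀ (by positivity)]
        calc |∑ x ∈ halfOpenBox 2 R, ∑ y ∈ halfOpenBox 2 R, C (x - y)|
            ≤ ∑ x ∈ halfOpenBox 2 R, |∑ y ∈ halfOpenBox 2 R, C (x - y)| :=
              Finset.abs_sum_le_sum_abs _ _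
          _ ≤ ∑ x ∈ halfOpenBox 2 R, ∑ y ∈ halfOpenBox 2 R, |C (x - y)| :=
              Finset.sum_le_sum fun x _ => Finset.abs_sum_le_sum_abs _ _
          _ ≤ ∑ x ∈ halfOpenBox 2 R, ∑ y ∈ halfOpenBox 2 R, B :=
              Finset.sum_le_sum fun x _ => Finset.sum_le_sum fun y _ => hCbd _
          _ = B * ((R : ℕ) : ℝ) ^ 4 := by
              rw [Finset.sum_const, Finset.sum_const, card_halfOpenBox, smul_smul, nsmul_eq_mul]
              push_cast
              ring
    exact (abs_le.1 habs).1
  -- Step 4: for every `η > 0` the atom is at most `2η`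
  have hkey : ∀ η : ℝ, 0 < η → liminf b atTop ≤ 2 * η := by
    intro η hη
    obtain ⟨ε, hε, L₀, hL₀⟩ := htight η hη
    -- the Fejér bound in the limit `j → ∞`, at every block scale `R > 0`
    have hR : ∀ R : ℕ, 0 < R → b R ≤ η + 2 * Real.pi ^ 2 * B / ((R : ℝ) ^ 2 * ε ^ 2) := by
      intro R hRpos
      have hbj : Tendsto (fun j => (∑ x ∈ halfOpenBox 2 R, ∑ y ∈ halfOpenBox 2 R,
          Cavg (Ls j) (x - y)) / ((R : ℕ) : ℝ) ^ 4) atTop (𝓝 (b R)) := by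
        rw [hb]
        exact (tendsto_finsetSum _ fun x _ => tendsto_finsetSum _ fun y _ =>
          hLs_conv (x - y)).div_const _
      have huj : Tendsto (fun j => u (Ls j) + η + 2 * Real.pi ^ 2 * B / ((R : ℝ) ^ 2 * ε ^ 2))
          atTop (𝓝 (0 + η + 2 * Real.pi ^ 2 * B / ((R : ℝ) ^ 2 * ε ^ 2))) :=
        (hu_tend'.add_const _).add_const _
      rw [zero_add] at huj
      refine le_of_tendsto_of_tendsto hbj huj ?_
      have hev : ∀ᶠ j in atTop, max L₀ 1 ≤ Ls j := hLs_mono.tendsto_atTop.eventually_ge_atTop _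
      filter_upwards [hev] with j hj
      obtain ⟨n, hn⟩ : ∃ n, Ls j = n + 1 := ⟨Ls j - 1, by omega⟩
      have hevn : Even (n + 1) := hn ▸ hLs_even j
      have hψn : star (ψ (n + 1)) ⬝ᵥ ψ (n + 1) = 1 := hnorm (n + 1) hevn
      have hwin := hL₀ (n + 1) hevn (by omega)
      have hwin' : (∑ m : TorusSite 2 (n + 1), if m ≠ 0 ∧ momentumNormSq (n + 1) m ≤ ε ^ 2 then
          pairStructureFactor dWaveFormFactor (n + 1) (ψ (n + 1)) m else 0) /
            ((n + 1 : ℕ) : ℝ) ^ 2 ≤ η := by rwa [div_le_iff₀ (by positivity)]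
      have hf := tightnessExchange_fejer_bound ψ n hψn R hRpos ε hε
      rw [← hB, ← hu] at hf
      rw [hn]
      simp only [hCavg]
      linarith
    -- hence eventually `b R ≤ 2η`
    have htail : Tendsto (fun R : ℕ => 2 * Real.pi ^ 2 * B / ((R : ℝ) ^ 2 * ε ^ 2)) atTop
        (𝓝 0) := by
      refine tendsto_const_nhds.div_atTop ?_
      exact ((tendsto_pow_atTop two_ne_zero).comp tendsto_natCast_atTop_atTop).atTop_mul_const
        (pow_pos hε 2)
    have hev : ∀ᶠ R : ℕ in atTop, b R ≤ 2 * η := by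
      filter_upwards [htail.eventually_le_const hη, eventually_gt_atTop 0] with R h1 h2
      linarith [hR R h2]
    exact liminf_le_of_frequently_le hev.frequently (isBoundedUnder_of ⟨-B, fun R => hb_low R⟩)
  have h := hkey (liminf b atTop / 4) (by positivity)
  linarith

end Summit.HubbardSuperconductivity.HubbardSuperconductivity.Theorems

end
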